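import Mathlib.Analysis.Complex.AbsMax
import Mathlib.Analysis.Complex.UpperHalfPlane.Topology
import Mathlib.Analysis.SpecialFunctions.Complex.Log
import Mathlib.Analysis.Calculus.MeanValue
import HarnessLib

/-!
# Rigidity of holomorphic self-maps of the half-plane normalised at infinity

Trunk T-STOCH (complex analysis; used for the strict growth of Loewner hulls). Let
`g : ℍₒ → ℍₒ` be holomorphic with the **hydrodynamic normalisation** `g(z) - z → 0` as `z → ∞`
in `ℍₒ`. Then

* `Complex.im_le_im_of_tendsto_sub_self` — `im z ≤ im g(z)` on `ℍₒ` (a boundary case of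
  Julia's lemma): the holomorphic function `exp (i (g - id))` has modulus `exp (im z - im g z)`,
  which is `≤ e^δ` on the line `im z = δ` (as `im g ≥ 0`) and `≤ e^ε` on large circles (by the
  normalisation); the maximum modulus principle on `{im z > δ, |z| < R}`
  (`Complex.norm_le_of_forall_mem_frontier_norm_le`) and `δ, ε → 0` give `|exp(i(g - id))| ≤ 1`.
* `Complex.eqOn_id_of_tendsto_sub_self` — if moreover `g` has a holomorphic left inverse
  `G : ℍₒ → ℍₒ` with the same normalisation, then `g = id`: both inequalities give
  `im g = im` on `ℍₒ`, so `exp (i (g - id))` has constant modulus `1`, hence is constant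
  (`Complex.eqOn_of_isPreconnected_of_isMaxOn_norm`), so `(g - id)' = 0`, `g - id` is constant,
  and the constant vanishes at infinity.

In particular a conformal automorphism of `ℍₒ` with `g(z) - z → 0` at `∞` is the identity; for
the Loewner chain this shows that the hulls `Kₜ`, `t > 0`, of a continuous driving function are
never empty (`Literature/Probability/RandomPlanarGeometry/LoewnerGrowth.lean`).

## References

* Ch. Pommerenke, *Boundary Behaviour of Conformal Maps*, Springer (1992), §4.3 (the angular
  derivative; Julia–Wolff lemma); G. F. Lawler, *Conformally Invariant Processes in the Plane*,
  AMS (2005), Ch. 4 §4.1, Thm. 4.6 (uniqueness of the hydrodynamically normalised map).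
-/

noncomputable section

open Set Filter Topology Metric Bornology
open UpperHalfPlane (upperHalfPlaneSet isOpen_upperHalfPlaneSet)

namespace Complex

variable {g G : ℂ → ℂ}

/-- From `g z - z → 0` at infinity in `ℍₒ`: beyond some radius, `‖g z - z‖ < ε`. [folklore] -/
theorem exists_forall_norm_sub_self_lt
    (hlim : Tendsto (fun z ↦ g z - z) (cocompact ℂ ⊓ 𝓟 upperHalfPlaneSet) (𝓝 0)) {ε : ℝ}
    (hε : 0 < ε) : ∃ R : ℝ, ∀ z ∈ upperHalfPlaneSet, R < ‖z‖ → ‖g z - z‖ < ε := by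
  have hev := hlim.eventually (ball_mem_nhds (0 : ℂ) hε)
  rw [← cobounded_eq_cocompact] at hev
  obtain ⟨R, -, hR⟩ := ((hasBasis_cobounded_compl_closedBall (0 : ℂ)).inf_principal _).eventually_iff.1 hev
  refine ⟨R, fun z hz hzR ↦ ?_⟩
  have := hR ⟨by simpa using hzR, hz⟩
  simpa using this

/-- **Boundary Julia lemma at `∞`, hydrodynamic normalisation.** If `g` is holomorphic on the
open upper half-plane, maps it into itself, and `g z - z → 0` as `z → ∞` within `ℍₒ`, then
`im z ≤ im (g z)` for all `z ∈ ℍₒ`. (Maximum modulus for `exp (i (g - id))` on truncated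
half-discs; a boundary case of the Julia–Wolff lemma, cf. Pommerenke (1992), §4.3.) [folklore] -/
theorem im_le_im_of_tendsto_sub_self (hg : DifferentiableOn ℂ g upperHalfPlaneSet)
    (hmaps : MapsTo g upperHalfPlaneSet upperHalfPlaneSet)
    (hlim : Tendsto (fun z ↦ g z - z) (cocompact ℂ ⊓ 𝓟 upperHalfPlaneSet) (𝓝 0))
    {z₀ : ℂ} (hz₀ : z₀ ∈ upperHalfPlaneSet) : z₀.im ≤ (g z₀).im := by
  have hz₀' : 0 < z₀.im := hz₀
  set f : ℂ → ℂ := fun z ↦ exp (I * (g z - z)) with hf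
  have hnorm : ∀ z, ‖f z‖ = Real.exp (z.im - (g z).im) := fun z ↦ by
    simp only [hf, norm_exp, mul_re, I_re, zero_mul, I_im, one_mul, zero_sub, sub_im, neg_sub]
  have hfd : DifferentiableOn ℂ f upperHalfPlaneSet :=
    ((differentiableOn_const I).mul (hg.sub differentiableOn_id)).cexp
  -- it suffices to bound `‖f z₀‖ ≤ e^ε` for every `ε > 0`
  suffices key : ∀ ε : ℝ, 0 < ε → ‖f z₀‖ ≤ Real.exp ε by
    by_contra hlt
    rw [not_le] at hlt
    have hε : 0 < (z₀.im - (g z₀).im) / 2 := by linarith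
    have := key _ hε
    rw [hnorm, Real.exp_le_exp] at this
    linarith
  intro ε hε
  obtain ⟨R₀, hR₀⟩ := exists_forall_norm_sub_self_lt hlim hε
  -- the truncated half-disc `V = {im z > δ} ∩ B(0, R)`
  set δ : ℝ := min ε z₀.im / 2 with hδ
  have hδpos : 0 < δ := by positivity
  have hδε : δ ≤ ε := by
    have := min_le_left ε z₀.im
    rw [hδ]; linarith
  have hδz₀ : δ < z₀.im := by
    have := min_le_right ε z₀.im
    rw [hδ]; linarith
  set R : ℝ := max R₀ ‖z₀‖ + 1 with hR
  set V : Set ℂ := {z : ℂ | δ < z.im} ∩ ball 0 R with hV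
  have hVH : closure V ⊆ upperHalfPlaneSet := by
    intro z hz
    have h1 : z ∈ closure {z : ℂ | δ < z.im} := closure_mono inter_subset_left hz
    have h2 : δ ≤ z.im := closure_lt_subset_le continuous_const continuous_im h1
    exact hδpos.trans_le h2
  have hz₀V : z₀ ∈ V := ⟨hδz₀, by
    rw [mem_ball_zero_iff, hR]; linarith [le_max_right R₀ ‖z₀‖]⟩
  have hbdd : IsBounded V := isBounded_ball.subset inter_subset_right
  have hdc : DiffContOnCl ℂ f V :=
    ⟨hfd.mono (subset_closure.trans hVH), (hfd.continuousOn).mono hVH⟩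
  refine norm_le_of_forall_mem_frontier_norm_le hbdd hdc (fun z hz ↦ ?_) (subset_closure hz₀V)
  -- the two parts of the frontier
  have hz' := frontier_inter_subset _ _ hz
  have hzH : z ∈ upperHalfPlaneSet := hVH (frontier_subset_closure hz)
  have hgim : 0 ≤ (g z).im := le_of_lt (hmaps hzH)
  rcases hz' with ⟨h1, -⟩ | ⟨h1, h2⟩
  · -- bottom edge `im z = δ`
    have him : z.im = δ := by
      have := frontier_lt_subset_eq continuous_const continuous_im h1
      exact (this : δ = z.im).symm
    rw [hnorm, Real.exp_le_exp, him]
    linarith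
  · -- outer arc `|z| = R`
    have hzR : ‖z‖ = R := by simpa using frontier_ball_subset_sphere h2
    have hR₀z : R₀ < ‖z‖ := by
      rw [hzR, hR]; linarith [le_max_left R₀ ‖z₀‖]
    have hlt := hR₀ z hzH hR₀z
    rw [hnorm, Real.exp_le_exp]
    have : z.im - (g z).im ≤ ‖g z - z‖ := by
      have h := abs_im_le_norm (g z - z)
      rw [sub_im] at h
      linarith [neg_abs_le ((g z).im - z.im)]
    linarith

/-- **Rigidity.** Let `g, G` be holomorphic self-maps of `ℍₒ` with `g z - z → 0` and
`G z - z → 0` at `∞` within `ℍₒ`, and `G ∘ g = id` on `ℍₒ`. Then `g = id` on `ℍₒ`. In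
particular a conformal automorphism of `ℍₒ` with the hydrodynamic normalisation is the identity.
This is the uniqueness clause of Lawler (2005), Thm. 4.6 ("`gₜ` is the unique conformal
transformation of `Hₜ` onto `ℍ` such that `gₜ(z) - z → 0`") in the case `Hₜ = ℍ`.
[cite: Lawler2005, Thm. 4.6] -/
theorem eqOn_id_of_tendsto_sub_self (hg : DifferentiableOn ℂ g upperHalfPlaneSet)
    (hmaps : MapsTo g upperHalfPlaneSet upperHalfPlaneSet)
    (hlim : Tendsto (fun z ↦ g z - z) (cocompact ℂ ⊓ 𝓟 upperHalfPlaneSet) (𝓝 0))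
    (hG : DifferentiableOn ℂ G upperHalfPlaneSet)
    (hGmaps : MapsTo G upperHalfPlaneSet upperHalfPlaneSet)
    (hGlim : Tendsto (fun z ↦ G z - z) (cocompact ℂ ⊓ 𝓟 upperHalfPlaneSet) (𝓝 0))
    (hGg : LeftInvOn G g upperHalfPlaneSet) : EqOn g id upperHalfPlaneSet := by
  -- `im g = im` on `ℍₒ`
  have him : ∀ z ∈ upperHalfPlaneSet, (g z).im = z.im := fun z hz ↦ by
    refine le_antisymm ?_ (im_le_im_of_tendsto_sub_self hg hmaps hlim hz)
    have := im_le_im_of_tendsto_sub_self hG hGmaps hGlim (hmaps hz)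
    rwa [hGg hz] at this
  -- `f = exp (i (g - id))` has modulus one, hence is constant
  set φ : ℂ → ℂ := fun z ↦ g z - z with hφ
  set f : ℂ → ℂ := fun z ↦ exp (I * φ z) with hf
  have hφd : DifferentiableOn ℂ φ upperHalfPlaneSet := hg.sub differentiableOn_id
  have hfd : DifferentiableOn ℂ f upperHalfPlaneSet := ((differentiableOn_const I).mul hφd).cexp
  have hnorm : ∀ z ∈ upperHalfPlaneSet, ‖f z‖ = 1 := fun z hz ↦ by
    simp only [hf, hφ, norm_exp, mul_re, I_re, zero_mul, I_im, one_mul, sub_im,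
      him z hz, sub_self, Real.exp_zero]
  have hI : I ∈ upperHalfPlaneSet := by simp [upperHalfPlaneSet]
  have hconv : Convex ℝ upperHalfPlaneSet := convex_halfSpace_im_gt 0
  have hfconst : EqOn f (Function.const ℂ (f I)) upperHalfPlaneSet :=
    eqOn_of_isPreconnected_of_isMaxOn_norm hconv.isPreconnected isOpen_upperHalfPlaneSet hfd hI
      fun z hz ↦ by
        change ‖f z‖ ≤ ‖f I‖
        rw [hnorm z hz, hnorm I hI]
  -- hence `φ' = 0` on `ℍₒ` and `φ` is constant there
  have hφ' : ∀ z ∈ upperHalfPlaneSet, deriv φ z = 0 := by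
    intro z hz
    have hnhds : upperHalfPlaneSet ∈ 𝓝 z := isOpen_upperHalfPlaneSet.mem_nhds hz
    have hφz : HasDerivAt φ (deriv φ z) z := (hφd.differentiableAt hnhds).hasDerivAt
    have hfz : HasDerivAt f (exp (I * φ z) * (I * deriv φ z)) z := (hφz.const_mul I).cexp
    have hfz' : HasDerivAt f 0 z := by
      have : f =ᶠ[𝓝 z] fun _ ↦ f I := Filter.eventuallyEq_of_mem hnhds hfconst
      exact (this.hasDerivAt_iff).2 (hasDerivAt_const z (f I))
    have h0 := hfz.unique hfz'
    have hexp : exp (I * φ z) ≠ 0 := exp_ne_zero _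
    have : I * deriv φ z = 0 := by
      rcases mul_eq_zero.1 h0 with h | h
      · exact absurd h hexp
      · exact h
    simpa [I_ne_zero] using this
  have hφconst : ∀ z ∈ upperHalfPlaneSet, φ z = φ I := fun z hz ↦
    hconv.is_const_of_fderivWithin_eq_zero hφd (fun x hx ↦ by
      rw [fderivWithin_of_isOpen isOpen_upperHalfPlaneSet hx]
      ext
      simp [hφ' x hx]) hz hI
  -- the constant vanishes at infinity
  have hc : φ I = 0 := by
    by_contra hne
    have hε : 0 < ‖φ I‖ / 2 := by positivity
    obtain ⟨R, hR⟩ := exists_forall_norm_sub_self_lt hlim hε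
    set z : ℂ := ((max R 0 + 1 : ℝ) : ℂ) * I with hz
    have hzH : z ∈ upperHalfPlaneSet := by
      change 0 < z.im
      simp [hz]; positivity
    have hzR : R < ‖z‖ := by
      rw [hz, norm_mul, norm_I, mul_one, Complex.norm_real, Real.norm_eq_abs,
        abs_of_pos (by positivity)]
      linarith [le_max_left R 0]
    have := hR z hzH hzR
    change ‖φ z‖ < _ at this
    rw [hφconst z hzH] at this
    linarith [norm_nonneg (φ I)]
  intro z hz
  have := hφconst z hz
  rw [hc] at this
  exact sub_eq_zero.1 this

end Complex
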